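import Mathlib
import HarnessLib
import Summits.HubbardSuperconductivity.HubbardSuperconductivity.Theorems.ThermalWedgeTwPureThermalBoundSectorIdentities

/-!
# Route `ThermalWedge`, item `stmt-HubbardSuperconductivity-1702` (`TwPureThermalBound`):
# the sector energies of the repulsive Hubbard model are Lipschitz in the particle number — part 2

Support file (`--supports stmt-HubbardSuperconductivity-1702`; no definition). With the orbit-sum identity
of part 1 (`ThermalWedgeTwPureThermalBoundSectorIdentities`) and the sector ground states / homogeneous
variational bound / weights of the tree (`HubbardOneParticleCost`: `exists_unit_groundState`,
`groundEnergyAt_mul_norm_le`, `sum_star_annihilation_mulVec_dotProduct`), for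
`H = H(t,U)` (`U ≥ 0`) on ANY finite graph and `E(K) = groundEnergyAt G t U K`:
`K·E(K−1) ≤ (K−1)·E(K)` (`ptb_mul_groundEnergyAt_pred_le`); on graphs of maximal degree `≤ Δ`,
`E(K) ≥ −Δ|t|K` (`ptb_neg_le_groundEnergyAt`), hence `E(K−1) ≤ E(K) + Δ|t|`; on graphs with a bipartite
sign, by particle–hole symmetry, `E(K+1) ≤ E(K) + Δ|t| + U` and
`|E(K) − E(K')| ≤ (Δ|t| + U)|K − K'|` (`ptb_abs_groundEnergyAt_sub_le`). Folklore (Ruelle 1969 §3).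
-/

set_option linter.dupNamespace false

noncomputable section

namespace Summit.HubbardSuperconductivity.HubbardSuperconductivity.Theorems

open Literature.MathematicalPhysics.QuantumLattice Literature.Probability.LatticeModels Matrix Finset
open scoped ComplexOrder

section Sector

variable {Λ : Type*} [LinearOrder Λ] [Fintype Λ] (G : SimpleGraph Λ) [DecidableRel G.Adj]

/-- **`K · E(K−1) ≤ (K−1) · E(K)`** for the repulsive (`U ≥ 0`) Hubbard model on any finite graph and
`1 ≤ K ≤ 2|Λ|`: the orbit-sum of `(K−1)`-particle trial vectors `c_oψ` of a `K`-particle ground state.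
[folklore] -/
theorem ptb_mul_groundEnergyAt_pred_le (t : ℝ) {U : ℝ} (hU : 0 ≤ U) {K : ℕ} (hK1 : 1 ≤ K)
    (hK : K ≤ 2 * Fintype.card Λ) :
    (K : ℝ) * groundEnergyAt G t U (K - 1) ≤ ((K : ℝ) - 1) * groundEnergyAt G t U K := by
  obtain ⟨ψ, hψK, hψ1, hHψ⟩ := ThermodynamicLimit.exists_unit_groundState G t U hK
  set E := groundEnergyAt G t U K with hEdef
  -- each `c_oψ` is a `(K-1)`-particle trial vector
  have hKs : K = K - 1 + 1 := (Nat.sub_add_cancel hK1).symm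
  have hφ : ∀ o : Orb Λ, IsNParticle (K - 1) (annihilation o *ᵥ ψ) := fun o =>
    IsNParticle.annihilation_mulVec_holds (hKs ▸ hψK) o
  have hvar : ∀ o : Orb Λ, groundEnergyAt G t U (K - 1) * (star (annihilation o *ᵥ ψ) ⬝ᵥ (annihilation o *ᵥ ψ)).re ≤
      (star (annihilation o *ᵥ ψ) ⬝ᵥ (hamiltonian G t U *ᵥ (annihilation o *ᵥ ψ))).re := fun o =>
    ThermodynamicLimit.groundEnergyAt_mul_norm_le G t U (hφ o)
  have hsum := Finset.sum_le_sum fun o (_ : o ∈ Finset.univ) => hvar o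
  have hweights : ∑ o : Orb Λ, (star (annihilation o *ᵥ ψ) ⬝ᵥ (annihilation o *ᵥ ψ)).re = K := by
    rw [← Complex.re_sum, ThermodynamicLimit.sum_star_annihilation_mulVec_dotProduct hψK hψ1]; simp
  rw [← Finset.mul_sum, hweights, ← Complex.re_sum,
    ptb_sum_expect_annihilation G t U hψK hHψ, hψ1] at hsum
  have hD : 0 ≤ (star ψ ⬝ᵥ ((∑ x : Λ, numberOp x 0 * numberOp x 1) *ᵥ ψ)).re := by
    rw [Matrix.sum_mulVec, dotProduct_sum, Complex.re_sum]
    refine Finset.sum_nonneg fun x _ => ?_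
    rw [← mulVec_mulVec]
    exact ThermodynamicLimit.re_dotProduct_numberOp_numberOp_nonneg ψ x
  have hre : (((K : ℂ) - 1) * (E : ℂ) * 1 - (U : ℂ) * (star ψ ⬝ᵥ ((∑ x : Λ, numberOp x 0 * numberOp x 1) *ᵥ ψ))).re =
      ((K : ℝ) - 1) * E - U * (star ψ ⬝ᵥ ((∑ x : Λ, numberOp x 0 * numberOp x 1) *ᵥ ψ)).re := by
    simp [Complex.mul_re, Complex.sub_re]
  rw [hre] at hsum
  have hUD := mul_nonneg hU hD
  rw [mul_comm] at hsum
  linarith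

/-- **A priori lower bound**: on a graph of maximal degree `≤ Δ`, for `U ≥ 0` and `K ≤ 2|Λ|`,
`E(K) ≥ −Δ|t|K` (each particle carries kinetic energy `≥ −Δ|t|`, the interaction is nonnegative).
[folklore] -/
theorem ptb_neg_le_groundEnergyAt {Δ : ℕ} (hΔ : ∀ x : Λ, (Finset.univ.filter fun y => G.Adj x y).card ≤ Δ)
    (t : ℝ) {U : ℝ} (hU : 0 ≤ U) {K : ℕ} (hK : K ≤ 2 * Fintype.card Λ) :
    -((Δ : ℝ) * |t| * K) ≤ groundEnergyAt G t U K := by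
  have hK' : K ≤ Fintype.card (Orb Λ) := by rwa [card_orb]
  refine le_csInf (ThermodynamicLimit.groundEnergySet_nonempty _ hK') ?_
  rintro E ⟨ψ, hψK, hψ1, rfl⟩
  change _ ≤ (star ψ ⬝ᵥ (hamiltonian G t U *ᵥ ψ)).re
  rw [ThermodynamicLimit.dotProduct_hamiltonian_mulVec, Complex.add_re]
  -- amplitudes `w(x,σ) = ‖c_{xσ}ψ‖²`
  set w : Λ → Fin 2 → ℝ := fun x σ => (star (annihilation (orb x σ) *ᵥ ψ) ⬝ᵥ (annihilation (orb x σ) *ᵥ ψ)).re with hw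
  have hw0 : ∀ x σ, 0 ≤ w x σ := fun x σ => by
    simpa [hw] using (Complex.nonneg_iff.mp (dotProduct_star_self_nonneg (annihilation (orb x σ) *ᵥ ψ))).1
  have hwsum : ∑ x : Λ, ∑ σ : Fin 2, w x σ = K := by
    have h : ∑ o : Orb Λ, (star (annihilation o *ᵥ ψ) ⬝ᵥ (annihilation o *ᵥ ψ)).re = K := by
      rw [← Complex.re_sum, ThermodynamicLimit.sum_star_annihilation_mulVec_dotProduct hψK hψ1]; simp
    rw [← (toLex : Λ × Fin 2 ≃ Orb Λ).sum_comp] at h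
    rw [← Fintype.sum_prod_type']
    simpa [hw, orb] using h
  -- the hopping part: `Re Σ_{x∼y,σ} ⟨c_xψ, c_yψ⟩ ≤ Σ_{x,σ} deg(x) w(x,σ) ≤ Δ K`
  set A : ℂ := ∑ x, ∑ y, ∑ σ : Fin 2, if G.Adj x y then
      star (annihilation (orb x σ) *ᵥ ψ) ⬝ᵥ (annihilation (orb y σ) *ᵥ ψ) else 0 with hA
  have hpair : ∀ (x y : Λ) (σ : Fin 2), (star (annihilation (orb x σ) *ᵥ ψ) ⬝ᵥ (annihilation (orb y σ) *ᵥ ψ)).re ≤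
      (w x σ + w y σ) / 2 := by
    intro x y σ
    -- `2 Re⟨u,v⟩ ≤ ‖u‖² + ‖v‖²` from `⟨u − v, u − v⟩ ≥ 0`
    set u := annihilation (orb x σ) *ᵥ ψ
    set v := annihilation (orb y σ) *ᵥ ψ
    have h := (Complex.nonneg_iff.mp (dotProduct_star_self_nonneg (u - v))).1
    rw [star_sub, sub_dotProduct, dotProduct_sub, dotProduct_sub] at h
    simp only [Complex.sub_re] at h
    have hsymm : (star v ⬝ᵥ u).re = (star u ⬝ᵥ v).re := by
      rw [star_dotProduct u v, Complex.star_def, Complex.conj_re]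
    rw [hsymm] at h
    have : (star u ⬝ᵥ v).re ≤ ((star u ⬝ᵥ u).re + (star v ⬝ᵥ v).re) / 2 := by linarith
    simpa [hw] using this
  have hAre : |A.re| ≤ (Δ : ℝ) * K := by
    -- both `A.re` and `-A.re` are bounded by the same degree sum (apply the pair bound to `(x,y)` and `(y,x)`)
    have hdeg : ∑ x : Λ, ∑ y : Λ, ∑ σ : Fin 2, (if G.Adj x y then (w x σ + w y σ) / 2 else 0) ≤ (Δ : ℝ) * K := by
      have hsplit : ∑ x : Λ, ∑ y : Λ, ∑ σ : Fin 2, (if G.Adj x y then (w x σ + w y σ) / 2 else 0) =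
          ∑ x : Λ, ∑ y : Λ, ∑ σ : Fin 2, (if G.Adj x y then w x σ else 0) := by
        have h1 : ∑ x : Λ, ∑ y : Λ, ∑ σ : Fin 2, (if G.Adj x y then w y σ / 2 else 0) =
            ∑ x : Λ, ∑ y : Λ, ∑ σ : Fin 2, (if G.Adj x y then w x σ / 2 else 0) := by
          rw [Finset.sum_comm]
          refine Finset.sum_congr rfl fun x _ => Finset.sum_congr rfl fun y _ => Finset.sum_congr rfl fun σ _ => ?_
          simp only [G.adj_comm x y]
        have h2 : ∀ x y σ, (if G.Adj x y then (w x σ + w y σ) / 2 else (0 : ℝ)) =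
            (if G.Adj x y then w x σ / 2 else 0) + (if G.Adj x y then w y σ / 2 else 0) := by
          intro x y σ; split_ifs <;> ring
        simp_rw [h2, Finset.sum_add_distrib]
        rw [h1, ← Finset.sum_add_distrib]
        refine Finset.sum_congr rfl fun x _ => ?_
        rw [← Finset.sum_add_distrib]
        refine Finset.sum_congr rfl fun y _ => ?_
        rw [← Finset.sum_add_distrib]
        refine Finset.sum_congr rfl fun σ _ => ?_
        split_ifs <;> ring
      rw [hsplit]
      calc ∑ x : Λ, ∑ y : Λ, ∑ σ : Fin 2, (if G.Adj x y then w x σ else 0)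
          = ∑ x : Λ, ((Finset.univ.filter fun y => G.Adj x y).card : ℝ) * ∑ σ : Fin 2, w x σ := by
            refine Finset.sum_congr rfl fun x _ => ?_
            rw [Finset.sum_comm, Finset.mul_sum]
            refine Finset.sum_congr rfl fun σ _ => ?_
            rw [← Finset.sum_filter, Finset.sum_const, nsmul_eq_mul]
        _ ≤ ∑ x : Λ, (Δ : ℝ) * ∑ σ : Fin 2, w x σ := Finset.sum_le_sum fun x _ =>
            mul_le_mul_of_nonneg_right (by exact_mod_cast hΔ x) (Finset.sum_nonneg fun σ _ => hw0 x σ)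
        _ = (Δ : ℝ) * K := by rw [← Finset.mul_sum, hwsum]
    have hup : A.re ≤ (Δ : ℝ) * K := by
      rw [hA, Complex.re_sum]
      refine le_trans (Finset.sum_le_sum fun x _ => ?_) hdeg
      rw [Complex.re_sum]
      refine Finset.sum_le_sum fun y _ => ?_
      rw [Complex.re_sum]
      refine Finset.sum_le_sum fun σ _ => ?_
      split_ifs
      · exact hpair x y σ
      · simp
    have hdown : -A.re ≤ (Δ : ℝ) * K := by
      rw [hA, Complex.re_sum, ← Finset.sum_neg_distrib]
      refine le_trans (Finset.sum_le_sum fun x _ => ?_) hdeg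
      rw [Complex.re_sum, ← Finset.sum_neg_distrib]
      refine Finset.sum_le_sum fun y _ => ?_
      rw [Complex.re_sum, ← Finset.sum_neg_distrib]
      refine Finset.sum_le_sum fun σ _ => ?_
      split_ifs
      · -- `-Re⟨u,v⟩ ≤ (‖u‖²+‖v‖²)/2` from `⟨u + v, u + v⟩ ≥ 0`
        set u := annihilation (orb x σ) *ᵥ ψ
        set v := annihilation (orb y σ) *ᵥ ψ
        have h := (Complex.nonneg_iff.mp (dotProduct_star_self_nonneg (u + v))).1
        rw [star_add, add_dotProduct, dotProduct_add, dotProduct_add] at h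
        simp only [Complex.add_re] at h
        have hsymm : (star v ⬝ᵥ u).re = (star u ⬝ᵥ v).re := by
          rw [star_dotProduct u v, Complex.star_def, Complex.conj_re]
        rw [hsymm] at h
        have : -(star u ⬝ᵥ v).re ≤ ((star u ⬝ᵥ u).re + (star v ⬝ᵥ v).re) / 2 := by linarith
        simpa [hw] using this
      · simp
    exact abs_le.2 ⟨by linarith, hup⟩
  have h1 : -((Δ : ℝ) * |t| * K) ≤ (-(t : ℂ) * A).re := by
    have h2 : (-(t : ℂ) * A).re = -(t * A.re) := by simp [Complex.mul_re]
    rw [h2]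
    have h3 : |t * A.re| ≤ |t| * ((Δ : ℝ) * K) := by rw [abs_mul]; exact mul_le_mul_of_nonneg_left hAre (abs_nonneg t)
    have h4 := (abs_le.1 h3).2
    nlinarith
  have h5 : 0 ≤ ((U : ℂ) * ∑ x, star ψ ⬝ᵥ (numberOp x 0 *ᵥ (numberOp x 1 *ᵥ ψ))).re := by
    rw [Complex.re_ofReal_mul, Complex.re_sum]
    exact mul_nonneg hU (Finset.sum_nonneg fun x _ => ThermodynamicLimit.re_dotProduct_numberOp_numberOp_nonneg ψ x)
  linarith

/-- **Removing a particle costs at most `Δ|t|`**: `E(K−1) ≤ E(K) + Δ|t|` (`U ≥ 0`, degree `≤ Δ`,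
`1 ≤ K ≤ 2|Λ|`). [folklore] -/
theorem ptb_groundEnergyAt_pred_le {Δ : ℕ} (hΔ : ∀ x : Λ, (Finset.univ.filter fun y => G.Adj x y).card ≤ Δ)
    (t : ℝ) {U : ℝ} (hU : 0 ≤ U) {K : ℕ} (hK1 : 1 ≤ K) (hK : K ≤ 2 * Fintype.card Λ) :
    groundEnergyAt G t U (K - 1) ≤ groundEnergyAt G t U K + Δ * |t| := by
  have h1 := ptb_mul_groundEnergyAt_pred_le G t hU hK1 hK
  have h2 := ptb_neg_le_groundEnergyAt G hΔ t hU hK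
  have hKpos : (0 : ℝ) < K := by exact_mod_cast hK1
  -- `K E(K-1) ≤ (K-1)E(K) = K E(K) - E(K) ≤ K E(K) + Δ|t|K`
  have h3 : (K : ℝ) * groundEnergyAt G t U (K - 1) ≤ (K : ℝ) * (groundEnergyAt G t U K + Δ * |t|) := by nlinarith
  exact le_of_mul_le_mul_left h3 hKpos

/-- Iterated: `E(K − j) ≤ E(K) + jΔ|t|` for `j ≤ K ≤ 2|Λ|`. [folklore] -/
theorem ptb_groundEnergyAt_sub_le {Δ : ℕ} (hΔ : ∀ x : Λ, (Finset.univ.filter fun y => G.Adj x y).card ≤ Δ)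
    (t : ℝ) {U : ℝ} (hU : 0 ≤ U) {K : ℕ} (hK : K ≤ 2 * Fintype.card Λ) (j : ℕ) (hj : j ≤ K) :
    groundEnergyAt G t U (K - j) ≤ groundEnergyAt G t U K + j * (Δ * |t|) := by
  induction j with
  | zero => simp
  | succ j ih =>
      have hj' : j ≤ K := Nat.le_of_succ_le hj
      have h1 : 1 ≤ K - j := by omega
      have h2 : K - j ≤ 2 * Fintype.card Λ := (Nat.sub_le K j).trans hK
      have h := ptb_groundEnergyAt_pred_le G hΔ t hU h1 h2
      rw [show K - j - 1 = K - (j + 1) by omega] at h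
      have := ih hj'
      push_cast
      linarith

/-- **Adding a particle costs at most `Δ|t| + U` on a bipartite graph** (particle–hole symmetry
`E(N) = E(2|Λ|−N) − (|Λ|−N)U`, then the removal bound at `2|Λ| − K`): `E(K+1) ≤ E(K) + Δ|t| + U` for
`K + 1 ≤ 2|Λ|`. [folklore] -/
theorem ptb_groundEnergyAt_succ_le {Δ : ℕ} (hΔ : ∀ x : Λ, (Finset.univ.filter fun y => G.Adj x y).card ≤ Δ)
    (ε : Λ → ℤˣ) (hε : ∀ x y, G.Adj x y → ε x = -ε y) (t : ℝ) {U : ℝ} (hU : 0 ≤ U) {K : ℕ}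
    (hK : K + 1 ≤ 2 * Fintype.card Λ) :
    groundEnergyAt G t U (K + 1) ≤ groundEnergyAt G t U K + Δ * |t| + U := by
  have hK' : K ≤ 2 * Fintype.card Λ := Nat.le_of_succ_le hK
  rw [groundEnergyAt_particleHole G ε hε t U hK, groundEnergyAt_particleHole G ε hε t U hK']
  have h1 : 1 ≤ 2 * Fintype.card Λ - K := by omega
  have h2 : 2 * Fintype.card Λ - K ≤ 2 * Fintype.card Λ := Nat.sub_le _ _
  have h := ptb_groundEnergyAt_pred_le G hΔ t hU h1 h2
  rw [show 2 * Fintype.card Λ - K - 1 = 2 * Fintype.card Λ - (K + 1) by omega] at h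
  push_cast
  nlinarith

/-- Iterated: `E(K + j) ≤ E(K) + j(Δ|t| + U)` for `K + j ≤ 2|Λ|` on a bipartite graph. [folklore] -/
theorem ptb_groundEnergyAt_add_le {Δ : ℕ} (hΔ : ∀ x : Λ, (Finset.univ.filter fun y => G.Adj x y).card ≤ Δ)
    (ε : Λ → ℤˣ) (hε : ∀ x y, G.Adj x y → ε x = -ε y) (t : ℝ) {U : ℝ} (hU : 0 ≤ U) {K : ℕ} (j : ℕ)
    (hK : K + j ≤ 2 * Fintype.card Λ) :
    groundEnergyAt G t U (K + j) ≤ groundEnergyAt G t U K + j * (Δ * |t| + U) := by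
  induction j with
  | zero => simp
  | succ j ih =>
      have h := ptb_groundEnergyAt_succ_le G hΔ ε hε t hU (K := K + j) (by omega)
      have := ih (by omega)
      rw [← add_assoc]
      push_cast
      linarith

/-- **The sector energies are Lipschitz in the particle number**: on a bipartite graph of maximal
degree `≤ Δ`, for `U ≥ 0` and `K, K' ≤ 2|Λ|`, `|E(K) − E(K')| ≤ (Δ|t| + U)|K − K'|`. [folklore] -/
theorem ptb_abs_groundEnergyAt_sub_le {Δ : ℕ} (hΔ : ∀ x : Λ, (Finset.univ.filter fun y => G.Adj x y).card ≤ Δ)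
    (ε : Λ → ℤˣ) (hε : ∀ x y, G.Adj x y → ε x = -ε y) (t : ℝ) {U : ℝ} (hU : 0 ≤ U) {K K' : ℕ}
    (hK : K ≤ 2 * Fintype.card Λ) (hK' : K' ≤ 2 * Fintype.card Λ) :
    |groundEnergyAt G t U K - groundEnergyAt G t U K'| ≤ (Δ * |t| + U) * |((K : ℝ) - K')| := by
  wlog hle : K' ≤ K generalizing K K'
  · have h := this hK' hK (le_of_not_ge hle)
    rwa [abs_sub_comm, abs_sub_comm (K' : ℝ)] at h
  obtain ⟨j, rfl⟩ := Nat.exists_eq_add_of_le hle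
  have hup := ptb_groundEnergyAt_add_le G hΔ ε hε t hU j hK
  have hdown := ptb_groundEnergyAt_sub_le G hΔ t hU hK j (Nat.le_add_left j K')
  rw [Nat.add_sub_cancel] at hdown
  have hj : |(((K' + j : ℕ) : ℝ)) - K'| = j := by push_cast; rw [add_sub_cancel_left, Nat.abs_cast]
  rw [hj, abs_le]
  have ht : 0 ≤ (j : ℝ) * U := by positivity
  constructor <;> nlinarith

end Sector

end Summit.HubbardSuperconductivity.HubbardSuperconductivity.Theorems

end
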